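import Literature.AlgebraicGeometry.Resolution.WeightedCentreGraphRestriction
import Literature.AlgebraicGeometry.Resolution.WeightedCentreResidualOrder
import Literature.AlgebraicGeometry.Resolution.WeightedCentrePowPairMax
import HarnessLib

/-!
# Bending beats splitting: `x^{p²} + y^p + y^{p+1}` in characteristic `p`

[ATW24] Abramovich–Temkin–Włodarczyk, *Functorial embedded resolution via weighted blowings up*,
Algebra & Number Theory 18 (2024), §5.1 (p. 1575: `inv = (a₁, …, a_k)` maximised over centres, the tail read
on the maximal contact `H = V(x₁)`), Thm. 5.3.1 (2)–(3) (p. 1578), Lemma 5.2.6 (p. 1576).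
[Hau10] Hauser, *On the problem of resolution of singularities in positive characteristic*, Bull. AMS 47
(2010), §C (p. 9, "Failure of maximal contact") and §D (p. 12, "Kangaroo phenomenon": "hypersurfaces of
maximal contact (which need not exist in arbitrary characteristic) have to be replaced by hypersurfaces of
weak maximal contact").  [HP19b] Hauser–Perlega, Publ. RIMS 60 (2024) 767–814, Introduction (p. 769:
"Due to the failure of maximal contact, the strict transform of the previously chosen hypersurface may not be
usable anymore") and §7 (p. 798: the residual order of `z^{p^e} + F`).
[HP19] Hauser–Perlega, J. Algebraic Geom. 28 (2019), §2 (cleaning of `p^e`-th powers, the residual order).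
[CJS20] Cossart–Jannsen–Saito, LNM 2270 (2020), Def. 8.2 / Thm. 8.16 (vertex preparation by `y ↦ y + q(u)`).

## What is proved (the polynomial `W(f)` model of `WeightedCentreInvariantSet`; all fields of characteristic `p`)

For every prime `p` let `F_p := x^{p²} + y^p + y^{p+1} ∈ k[x, y]` (`x = X 0`, `y = X 1`, `char k = p`).
The SPLIT LAW of `WeightedCentreGraphRestriction` / `WeightedCentreResidualOrder` says: a maximal centre of
`W(F_p)` possessing an affine `x`-regular slot `z_j = c·x + ψ(y)` of exponent `≤ p²` has invariant
`sort (p², ν, …)` with `ν ≤ p` the `p²`-residual order of `y^p + y^{p+1}` — at best `(p, p²)`.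

* `isCentreFor_bending` — the BENT centre `J = ((y + x^p + x^{p+1})^{1/p}, x^{1/(p²+p+1)})`, i.e. the coordinate
  change `y ↦ y + x^p + x^{p+1}` (an `addPolyShear`) with weights `1/p` on `y` and `1/(p² + p + 1)` on `x`, is
  admissible for `F_p`: in the new coordinate `F_p = y^p + y^{p+1} − y^p x^p − y^p x^{p+1} − y x^{p²} − y x^{p²+p}
  + x^{p²+p+1} + x^{p²+2p} + x^{p²+2p+1}` (the terms `x^{p²}` and `x^{p²+p}` CANCEL by the Frobenius identities
  `(a + b)^p = a^p + b^p`), and every remaining monomial has weight `≥ 1`.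
* `bending_mem_admissibleInvariants` — hence **`(p, p² + p + 1) ∈ W(x^{p²} + y^p + y^{p+1})`**;
  `bending_mem_admissibleInvariants_two` — `(2, 7) ∈ W(x⁴ + y² + y³)` in characteristic `2`.
* `insertionSort_cons_lt_bending` — **every split value is strictly below it**: for every `p²`-residual
  invariant `b ∈ C_{p²}(y^p + y^{p+1})` (relative to `x`), `sort (p² :: b) < (p, p² + p + 1)` in the truncated
  lexicographic order (by Lemma N of `WeightedCentreResidualOrder`, `b` starts with an entry `≤ p`).
* `lt_inv_of_isMaxInv_of_graph_bending` — consequently **no maximal centre of `W(F_p)` is split**: if a centre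
  `(Ψ, w)` realises `max W(F_p)` and one of its coordinates is `Ψ(X j) = c·x + ψ` with `c ≠ 0`, `ψ` free of `x`,
  `w j ≠ 0`, then its exponent `(w j)⁻¹` is `> p²` (Lemma S of `WeightedCentreGraphRestriction` would otherwise
  force `exps w = sort (p² :: b)` for a residual invariant `b`, which the bent centre beats).

* `bentForm`, `addPolyShear_symm_bending` — `F_p` in the bent coordinates, as an explicit nine-term polynomial;
  `monomialOrd_bentForm` (`ord = p`), `homogeneousComponent_bentForm` (`in_p = y^p`, so `τ = 1`),
  `hironakaDelta_bentForm` (**`δ(G_p; x; y) = (p² + p + 1)/p`**, attained only at the vertex `x^{p²+p+1}`),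
  `isDeltaPrepared_bentForm` (the `δ`-face vertex is not a lattice point since `p ∤ p² + p + 1`, so `G_p` is
  `δ`-prepared — vacuously, no integral vertex lies on the `δ`-face).
* `not_lt_of_mem_admissibleInvariants_bending`, **`isMaxInv_bending` — `max W(x^{p²} + y^p + y^{p+1}) =
  (p, p² + p + 1)`** over all admissible centres after all polynomial coordinate changes (the vertex theorem
  `succ_card_le_countP_exps_of_isDeltaPrepared` of `WeightedCentreVertexPreparation` applied to `G_p`, transported
  back by `admissibleInvariants_map_eq`); `isMaxInv_bending_two` — **`max W(x⁴ + y² + y³) = (2, 7)`** in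
  characteristic `2`.

This is the first typed instance in the tree of the observatory's "bending" phenomenon (engine 1, FE36
Thm. H, case `e = 2`, `r = 1`: `max = (p, q + r(q−1)/(p−1))` with `q = p²`, i.e. `(p, p² + p + 1)`; for
`p = 2`: `max W(x⁴ + y² + y³) = (2, 7)`, NOT the split value `(2, 4)`) — now with maximality.
Value type: typed theorems in the polynomial `W(f)` model — not a resolution theorem.
-/

noncomputable section

open MvPolynomial

namespace Literature.AlgebraicGeometry.Resolution

namespace WeightedBlowup

variable {k : Type*} [Field k]

/-! ## §1 Plumbing -/

/-- The inverse shear on the sheared variable (plumbing). [folklore] -/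
private theorem addPolyShear_symm_X_self₁₇ {σ : Type*} [DecidableEq σ] (a : σ) (q : MvPolynomial σ k) :
    (addPolyShear a q).symm (X a) = X a - killVar a q := by
  simp [addPolyShear, sub_eq_add_neg]

/-- The inverse shear fixes the other variables (plumbing). [folklore] -/
private theorem addPolyShear_symm_X_of_ne₁₇ {σ : Type*} [DecidableEq σ] (a : σ) (q : MvPolynomial σ k) {x : σ}
    (hx : x ≠ a) : (addPolyShear a q).symm (X x) = X x := by
  simp [addPolyShear, hx]

/-- `ν_w(x^i y^j) = i·w₀ + j·w₁` (plumbing). [cite: AbramovichTemkinWlodarczyk2024, Rem. 2.4.2 (p. 1568)] -/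
private theorem monomialOrd_X_pow_mul_X_pow₁₇ (w : Fin 2 → ℕ) (i j : ℕ) :
    monomialOrd w (X 0 ^ i * X 1 ^ j : MvPolynomial (Fin 2) k) = ((i * w 0 + j * w 1 : ℕ) : ℕ∞) := by
  rw [monomialOrd_mul, X_pow_eq_monomial, X_pow_eq_monomial, monomialOrd_monomial w _ one_ne_zero,
    monomialOrd_monomial w _ one_ne_zero, Finsupp.weight_single, Finsupp.weight_single, smul_eq_mul, smul_eq_mul,
    Nat.cast_add]

/-- `ν_w(−F) = ν_w(F)` (plumbing). [cite: AbramovichTemkinWlodarczyk2024, Rem. 5.2.3] -/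
private theorem monomialOrd_neg₁₇ {σ : Type*} (w : σ → ℕ) (F : MvPolynomial σ k) :
    monomialOrd w (-F) = monomialOrd w F := by
  rw [show -F = C (-1 : k) * F by rw [C_neg, C_1, neg_one_mul]]
  exact monomialOrd_mul_of_constantCoeff_ne_zero w (by rw [constantCoeff_C]; exact neg_ne_zero.2 one_ne_zero) F

/-- `n ≤ ν(A)`, `n ≤ ν(B)` ⟹ `n ≤ ν(A + B)` (plumbing). [cite: AbramovichTemkinWlodarczyk2024, Lemma 5.2.6] -/
private theorem le_monomialOrd_add₁₇ {σ : Type*} (w : σ → ℕ) {A B : MvPolynomial σ k} {n : ℕ∞}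
    (hA : n ≤ monomialOrd w A) (hB : n ≤ monomialOrd w B) : n ≤ monomialOrd w (A + B) :=
  le_trans (le_min hA hB) (min_monomialOrd_le_add w A B)

/-- `n ≤ ν(A)`, `n ≤ ν(B)` ⟹ `n ≤ ν(A − B)` (plumbing). [cite: AbramovichTemkinWlodarczyk2024, Lemma 5.2.6] -/
private theorem le_monomialOrd_sub₁₇ {σ : Type*} (w : σ → ℕ) {A B : MvPolynomial σ k} {n : ℕ∞}
    (hA : n ≤ monomialOrd w A) (hB : n ≤ monomialOrd w B) : n ≤ monomialOrd w (A - B) := by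
  rw [sub_eq_add_neg]
  exact le_monomialOrd_add₁₇ w hA (by rwa [monomialOrd_neg₁₇])

/-- `ν_w(x_a^i) = i·w_a` (plumbing). [cite: AbramovichTemkinWlodarczyk2024, Rem. 2.4.2 (p. 1568)] -/
private theorem monomialOrd_X_pow₁₇ (w : Fin 2 → ℕ) (a : Fin 2) (i : ℕ) :
    monomialOrd w (X a ^ i : MvPolynomial (Fin 2) k) = ((i * w a : ℕ) : ℕ∞) := by
  rw [X_pow_eq_monomial, monomialOrd_monomial w _ one_ne_zero, Finsupp.weight_single, smul_eq_mul]

/-- Coefficients of `x^i y^j` (plumbing). [folklore] -/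
private theorem coeff_X_pow_mul_X_pow₁₇ (i j : ℕ) (d : Fin 2 →₀ ℕ) :
    coeff d (X 0 ^ i * X 1 ^ j : MvPolynomial (Fin 2) k) =
      if Finsupp.single (0 : Fin 2) i + Finsupp.single 1 j = d then 1 else 0 := by
  classical
  rw [X_pow_eq_monomial, X_pow_eq_monomial, monomial_mul, mul_one, coeff_monomial]

/-- The support of `x^i y^j` (plumbing). [folklore] -/
private theorem support_X_pow_mul_X_pow₁₇ (i j : ℕ) :
    (X 0 ^ i * X 1 ^ j : MvPolynomial (Fin 2) k).support ⊆ {Finsupp.single (0 : Fin 2) i + Finsupp.single 1 j} := by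
  classical
  rw [X_pow_eq_monomial, X_pow_eq_monomial, monomial_mul, mul_one]
  exact support_monomial_subset

/-- The exponent `(i, j)` evaluated (plumbing). [folklore] -/
private theorem e_apply_zero₁₇ (i j : ℕ) : (Finsupp.single (0 : Fin 2) i + Finsupp.single 1 j : Fin 2 →₀ ℕ) 0 = i := by
  simp

/-- The exponent `(i, j)` evaluated (plumbing). [folklore] -/
private theorem e_apply_one₁₇ (i j : ℕ) : (Finsupp.single (0 : Fin 2) i + Finsupp.single 1 j : Fin 2 →₀ ℕ) 1 = j := by
  simp

/-- The total degree of the exponent `(i, j)` (plumbing). [folklore] -/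
private theorem degree_e₁₇ (i j : ℕ) : (Finsupp.single (0 : Fin 2) i + Finsupp.single 1 j : Fin 2 →₀ ℕ).degree = i + j := by
  rw [map_add, Finsupp.degree_single, Finsupp.degree_single]

/-- Exponents `(i, j)` are determined by `i` and `j` (plumbing). [folklore] -/
private theorem e_eq_e_iff₁₇ {i j i' j' : ℕ} :
    (Finsupp.single (0 : Fin 2) i + Finsupp.single 1 j : Fin 2 →₀ ℕ) = Finsupp.single 0 i' + Finsupp.single 1 j' ↔
      i = i' ∧ j = j' := by
  constructor
  · intro h
    have h0 := DFunLike.congr_fun h 0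
    have h1 := DFunLike.congr_fun h 1
    rw [e_apply_zero₁₇, e_apply_zero₁₇] at h0
    rw [e_apply_one₁₇, e_apply_one₁₇] at h1
    exact ⟨h0, h1⟩
  · rintro ⟨rfl, rfl⟩
    rfl

/-- The head of a sorted list is its minimum (plumbing). [folklore] -/
private theorem le_of_mem_of_pairwise₁₇ {c x : ℚ} {es : List ℚ} (hs : (c :: es).Pairwise (· ≤ ·))
    (hx : x ∈ c :: es) : c ≤ x := by
  rcases List.mem_cons.1 hx with rfl | hx
  · exact le_rfl
  · exact (List.pairwise_cons.1 hs).1 x hx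

/-- An entry of the invariant (plumbing). [folklore] -/
private theorem inv_mem_exps₁₇ {N : ℕ} {γ : Fin N → ℚ} {x : Fin N} (hx : γ x ≠ 0) : (γ x)⁻¹ ∈ exps γ := by
  classical
  unfold exps
  rw [List.mem_insertionSort, List.mem_map]
  exact ⟨x, Finset.mem_toList.2 (Finset.mem_filter.2 ⟨Finset.mem_univ _, hx⟩), rfl⟩

/-! ## §2 The bent centre for `x^{p²} + y^p + y^{p+1}` -/

/-- **The bent form** `G_p = F_p(x, y − x^p − x^{p+1})` of `F_p = x^{p²} + y^p + y^{p+1}` in characteristic `p`,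
written as an explicit nine-term polynomial (`x = X 0`, `y = X 1`; Frobenius has cancelled `x^{p²}` and
`x^{p²+p}`): `y^p + y^{p+1} + x^{p²+p+1} + x^{p²+2p} + x^{p²+2p+1} − (y^p x^p + y^p x^{p+1} + y x^{p²} + y x^{p²+p})`.
(Ours, model-internal.) [cite: CossartJannsenSaito2020, Def. 8.2 / Thm. 8.16 (p. 121) (the prepared form after
y ↦ y + q(u))] [cite: Hauser2010, §D (p. 12)] -/
def bentForm (k : Type*) [Field k] (p : ℕ) : MvPolynomial (Fin 2) k :=
  X 0 ^ 0 * X 1 ^ p + X 0 ^ 0 * X 1 ^ (p + 1) + X 0 ^ (p ^ 2 + p + 1) * X 1 ^ 0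
    + X 0 ^ (p ^ 2 + 2 * p) * X 1 ^ 0 + X 0 ^ (p ^ 2 + 2 * p + 1) * X 1 ^ 0
    - (X 0 ^ p * X 1 ^ p + X 0 ^ (p + 1) * X 1 ^ p + X 0 ^ (p ^ 2) * X 1 ^ 1 + X 0 ^ (p ^ 2 + p) * X 1 ^ 1)

section Bending

variable (p : ℕ) [hp : Fact p.Prime] [CharP k p]

omit hp [CharP k p] in
/-- `y` does not occur in the shift `x^p + x^{p+1}` (plumbing). [folklore] -/
private theorem one_notMem_vars_shift₁₇ :
    (1 : Fin 2) ∉ (X 0 ^ p + X 0 ^ (p + 1) : MvPolynomial (Fin 2) k).vars := by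
  classical
  have h10 : (1 : Fin 2) ≠ 0 := by decide
  intro h
  rcases Finset.mem_union.1 (vars_add_subset _ _ h) with h' | h' <;>
    exact h10 (by simpa [vars_X] using vars_pow _ _ h')

omit [CharP k p] in
/-- The shift vanishes at the origin (plumbing). [folklore] -/
private theorem constantCoeff_shift₁₇ :
    constantCoeff (X 0 ^ p + X 0 ^ (p + 1) : MvPolynomial (Fin 2) k) = 0 := by
  simp only [map_add, map_pow, constantCoeff_X, zero_pow hp.out.pos.ne', zero_pow (Nat.succ_ne_zero p),
    add_zero]

/-- **`F_p` in the bent coordinates is the bent form**: `(y ↦ y + x^p + x^{p+1})⁻¹ · F_p = G_p`, by the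
Frobenius identities `(y − γ)^p = y^p − γ^p`, `γ^p = x^{p²} + x^{p²+p}` for `γ = x^p + x^{p+1}`. (derived here)
[cite: CossartJannsenSaito2020, Def. 8.2 / Thm. 8.16 (p. 121)] [cite: Hauser2010, §D (p. 12)] -/
theorem addPolyShear_symm_bending :
    (addPolyShear 1 (X 0 ^ p + X 0 ^ (p + 1))).symm
      (X 0 ^ p ^ 2 + (X 1 ^ p + X 1 ^ (p + 1)) : MvPolynomial (Fin 2) k) = bentForm k p := by
  classical
  have h01 : (0 : Fin 2) ≠ 1 := by decide
  haveI : ExpChar (MvPolynomial (Fin 2) k) p := ExpChar.prime hp.out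
  have hsymm1 : (addPolyShear 1 (X 0 ^ p + X 0 ^ (p + 1))).symm (X 1 : MvPolynomial (Fin 2) k) =
      X 1 - (X 0 ^ p + X 0 ^ (p + 1)) := by
    rw [addPolyShear_symm_X_self₁₇, killVar_eq_self_of_notMem (one_notMem_vars_shift₁₇ (k := k) p)]
  have hsymm0 : (addPolyShear 1 (X 0 ^ p + X 0 ^ (p + 1))).symm (X 0 : MvPolynomial (Fin 2) k) = X 0 :=
    addPolyShear_symm_X_of_ne₁₇ 1 _ h01
  have hγp : (X 0 ^ p + X 0 ^ (p + 1) : MvPolynomial (Fin 2) k) ^ p = X 0 ^ (p * p) + X 0 ^ ((p + 1) * p) := by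
    rw [add_pow_expChar, ← pow_mul, ← pow_mul]
  rw [map_add, map_add, map_pow, map_pow, map_pow, hsymm0, hsymm1, pow_succ (X 1 - (X 0 ^ p + X 0 ^ (p + 1))) p,
    sub_pow_expChar, hγp, bentForm]
  ring

/-- **The bent centre is admissible**: for `F_p = x^{p²} + y^p + y^{p+1}` in characteristic `p`, the coordinate
change `y ↦ y + x^p + x^{p+1}` with weights `1/p` on `y`, `1/(p² + p + 1)` on `x` is a centre for `F_p`
(`x^{p²}` and `x^{p²+p}` cancel by Frobenius; the surviving monomials `y^p, y^{p+1}, y^p x^p, y^p x^{p+1}, y x^{p²},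
y x^{p²+p}, x^{p²+p+1}, x^{p²+2p}, x^{p²+2p+1}` all have weight `≥ 1`). (derived here)
[cite: AbramovichTemkinWlodarczyk2024, Thm. 5.3.1 (2) (p. 1578), Lemma 5.2.6 (p. 1576)]
[cite: Hauser2010, §C (p. 9) and §D (p. 12) (failure of maximal contact; kangaroo phenomenon)]
[cite: CossartJannsenSaito2020, Def. 8.2 / Thm. 8.16 (p. 121) (preparation by y ↦ y + q(u))] -/
theorem isCentreFor_bending :
    IsCentreFor (X 0 ^ p ^ 2 + (X 1 ^ p + X 1 ^ (p + 1)) : MvPolynomial (Fin 2) k)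
      (addPolyShear 1 (X 0 ^ p + X 0 ^ (p + 1)))
      (singleWeights (1 : Fin 2) p + singleWeights (0 : Fin 2) (p ^ 2 + p + 1)) := by
  classical
  have hp0 : 0 < p := hp.out.pos
  have h10 : (1 : Fin 2) ≠ 0 := by decide
  have h01 : (0 : Fin 2) ≠ 1 := by decide
  have hF := addPolyShear_symm_bending (k := k) p
  rw [bentForm] at hF
  refine ⟨constantCoeff_addPolyShear_X 1 (constantCoeff_shift₁₇ (k := k) p), fun x => ?_, ?_⟩
  · simp only [Pi.add_apply, singleWeights]
    split_ifs <;> positivity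
  · have hw : ∀ i : Fin 2, (((fun i : Fin 2 => if i = 0 then p else p ^ 2 + p + 1) i : ℕ) : ℚ) =
        ((p * (p ^ 2 + p + 1) : ℕ) : ℚ) * (singleWeights (1 : Fin 2) p + singleWeights (0 : Fin 2) (p ^ 2 + p + 1)) i := by
      have hpq : (p : ℚ) ≠ 0 := by exact_mod_cast hp0.ne'
      have hqq : ((p ^ 2 + p + 1 : ℕ) : ℚ) ≠ 0 := by positivity
      intro i
      fin_cases i
      · simp only [Fin.zero_eta, ↓reduceIte, Pi.add_apply, singleWeights, if_neg h01, zero_add, Nat.cast_mul]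
        rw [mul_inv_cancel_right₀ hqq]
      · simp only [Fin.mk_one, if_neg h10, Pi.add_apply, singleWeights, ↓reduceIte, add_zero, Nat.cast_mul]
        rw [mul_comm ((p : ℕ) : ℚ), mul_inv_cancel_right₀ hpq]
    rw [hF, isAdmissibleFor_iff_le_monomialOrd _ (fun i : Fin 2 => if i = 0 then p else p ^ 2 + p + 1)
      (N := p * (p ^ 2 + p + 1)) (by positivity) hw]
    refine le_monomialOrd_sub₁₇ _
      (le_monomialOrd_add₁₇ _ (le_monomialOrd_add₁₇ _ (le_monomialOrd_add₁₇ _ (le_monomialOrd_add₁₇ _ ?_ ?_) ?_) ?_) ?_)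
      (le_monomialOrd_add₁₇ _ (le_monomialOrd_add₁₇ _ (le_monomialOrd_add₁₇ _ ?_ ?_) ?_) ?_)
    all_goals
      rw [monomialOrd_X_pow_mul_X_pow₁₇]
      simp only [↓reduceIte, if_neg h10]
      exact_mod_cast by nlinarith [hp0]

/-- **`(p, p² + p + 1) ∈ W(x^{p²} + y^p + y^{p+1})`** in characteristic `p` (the bent centre's invariant).
(derived here) [cite: AbramovichTemkinWlodarczyk2024, Thm. 5.3.1 (2) (p. 1578)]
[cite: Hauser2010, §C (p. 9) (failure of maximal contact in characteristic p)] -/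
theorem bending_mem_admissibleInvariants :
    [(p : ℚ), ((p ^ 2 + p + 1 : ℕ) : ℚ)] ∈
      admissibleInvariants (X 0 ^ p ^ 2 + (X 1 ^ p + X 1 ^ (p + 1)) : MvPolynomial (Fin 2) k) := by
  classical
  have hc := isCentreFor_bending (k := k) p
  have hdisj : ∀ x : Fin 2, singleWeights (1 : Fin 2) p x = 0 ∨ singleWeights (0 : Fin 2) (p ^ 2 + p + 1) x = 0 := by
    intro x
    by_cases hx : x = 0
    · subst hx; left; simp [singleWeights]
    · right; simp [singleWeights, hx]
  have hle : (p : ℚ) ≤ ((p ^ 2 + p + 1 : ℕ) : ℚ) := by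
    exact_mod_cast (Nat.le_add_left p (p ^ 2)).trans (Nat.le_succ _)
  have hew : exps (singleWeights (1 : Fin 2) p + singleWeights (0 : Fin 2) (p ^ 2 + p + 1)) =
      [(p : ℚ), ((p ^ 2 + p + 1 : ℕ) : ℚ)] := by
    rw [exps_add_eq hdisj, exps_singleWeights 1 hp.out.pos, exps_singleWeights 0 (by positivity),
      List.singleton_append, List.insertionSort_cons, List.insertionSort_cons, List.insertionSort_nil,
      List.orderedInsert_nil, List.orderedInsert_cons_of_le _ _ hle]
  rw [← hew]
  exact exps_mem_admissibleInvariants hc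

/-- **Every split value is beaten by the bent centre**: for every `p²`-residual invariant `b` of `y^p + y^{p+1}`
relative to `x` (the candidates for the tail of a split maximal centre, Lemma R/S of
`WeightedCentreGraphRestriction`), `sort (p² :: b) < (p, p² + p + 1)` — because `b` starts with an entry `≤ p`
(Lemma N, the monomial `y^p` is not a `p²`-th power). (derived here)
[cite: AbramovichTemkinWlodarczyk2024, §5.1 (p. 1575), Thm. 5.3.1 (2)–(3) (p. 1578)]
[cite: HauserPerlega2019, §2 (residual order after cleaning p^e-th powers)] -/
theorem insertionSort_cons_lt_bending {b : List ℚ}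
    (hb : b ∈ residualInvariants (p ^ 2) (0 : Fin 2) (X 1 ^ p + X 1 ^ (p + 1) : MvPolynomial (Fin 2) k)) :
    ATW.TruncLex.lt ((((p ^ 2 : ℕ) : ℚ) :: b).insertionSort (· ≤ ·)) [(p : ℚ), ((p ^ 2 + p + 1 : ℕ) : ℚ)] := by
  classical
  have hp0 : 0 < p := hp.out.pos
  have hp2 : 2 ≤ p := hp.out.two_le
  have hdh : Finsupp.single (1 : Fin 2) p ∈ (X 1 ^ p + X 1 ^ (p + 1) : MvPolynomial (Fin 2) k).support := by
    rw [mem_support_iff, coeff_add, coeff_X_pow, coeff_X_pow, if_pos rfl, if_neg, add_zero]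
    · exact one_ne_zero
    · intro h
      have := Finsupp.single_injective (1 : Fin 2) h
      omega
  have hd : ∃ i, ¬ p ^ 2 ∣ (Finsupp.single (1 : Fin 2) p) i := by
    refine ⟨1, ?_⟩
    rw [Finsupp.single_eq_same]
    intro h
    have h1 := Nat.le_of_dvd hp0 h
    have h2 : p < p ^ 2 := by nlinarith
    omega
  obtain ⟨e, es, rfl, hle⟩ := exists_eq_cons_le_of_mem_residualInvariants p 2 (0 : Fin 2) hdh hd hb
  rw [Finsupp.degree_single] at hle
  have hsorted : (e :: es).Pairwise (· ≤ ·) := by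
    obtain ⟨γ, Ψ, w, -, -, -, -, -, hw⟩ := hb
    rw [← hw]
    exact exps_sorted w
  have hpp : (p : ℚ) < ((p ^ 2 : ℕ) : ℚ) := by
    exact_mod_cast (show p < p ^ 2 by nlinarith)
  have hq : ((p ^ 2 : ℕ) : ℚ) < ((p ^ 2 + p + 1 : ℕ) : ℚ) := by
    exact_mod_cast Nat.lt_succ_of_le (Nat.le_add_right (p ^ 2) p)
  have hnot : ¬ ((p ^ 2 : ℕ) : ℚ) ≤ e := not_le.2 (hle.trans_lt hpp)
  rw [List.insertionSort_cons, hsorted.insertionSort_eq, List.orderedInsert_cons, if_neg hnot,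
    ATW.TruncLex.cons_lt_cons]
  rcases hle.lt_or_eq with hlt | heq
  · exact Or.inl hlt
  · refine Or.inr ⟨heq, ?_⟩
    cases es with
    | nil => simpa [List.orderedInsert] using ATW.TruncLex.cons_lt_cons.2 (Or.inl hq)
    | cons x xs =>
      rw [List.orderedInsert_cons]
      split_ifs with hx
      · exact ATW.TruncLex.cons_lt_cons.2 (Or.inl hq)
      · exact ATW.TruncLex.cons_lt_cons.2 (Or.inl ((not_le.1 hx).trans hq))

omit hp [CharP k p] in
/-- `x` does not occur in `y^p + y^{p+1}` (plumbing). [folklore] -/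
private theorem zero_notMem_vars_h₁₇ :
    (0 : Fin 2) ∉ (X 1 ^ p + X 1 ^ (p + 1) : MvPolynomial (Fin 2) k).vars := by
  classical
  have h01 : (0 : Fin 2) ≠ 1 := by decide
  intro h
  rcases Finset.mem_union.1 (vars_add_subset _ _ h) with h' | h' <;>
    exact h01 (by simpa [vars_X] using vars_pow _ _ h')

/-- **No maximal centre of `W(x^{p²} + y^p + y^{p+1})` is split** (characteristic `p`): if `(Ψ, w)` realises
`max W` and a coordinate of `Ψ` is affine `x`-regular, `Ψ(X j) = c·x + ψ` (`c ≠ 0`, `ψ` free of `x`,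
`w j ≠ 0`), then its exponent exceeds `p²`: `(w j)⁻¹ > p²`.  (Lemma S would otherwise make the maximum a split
value `sort (p² :: b)`, which the bent centre's `(p, p² + p + 1) ∈ W` beats.)  So for these equations the
ATW-style reading "first coordinate of the maximal centre = a smooth maximal-contact-like hypersurface of
exponent `ord = p²` or less" fails — the typed shadow of the kangaroo phenomenon. (derived here)
[cite: AbramovichTemkinWlodarczyk2024, §5.1 (p. 1575), Thm. 5.3.1 (2)–(3) (p. 1578)]
[cite: Hauser2010, §C (p. 9), §D (p. 12) (maximal contact need not exist in characteristic p)]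
[cite: HauserPerlega2019PRIMS, Introduction (p. 769) and §7 (p. 798)] -/
theorem lt_inv_of_isMaxInv_of_graph_bending
    {Ψ : MvPolynomial (Fin 2) k ≃ₐ[k] MvPolynomial (Fin 2) k} {w : Fin 2 → ℚ}
    (hc : IsCentreFor (X 0 ^ p ^ 2 + (X 1 ^ p + X 1 ^ (p + 1)) : MvPolynomial (Fin 2) k) Ψ w)
    (hmax : IsMaxInv (admissibleInvariants (X 0 ^ p ^ 2 + (X 1 ^ p + X 1 ^ (p + 1)) : MvPolynomial (Fin 2) k))
      (exps w))
    {j : Fin 2} {c : k} {ψ : MvPolynomial (Fin 2) k} (hc0 : c ≠ 0) (hψ : (0 : Fin 2) ∉ ψ.vars)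
    (hj : Ψ (X j) = C c * X 0 + ψ) (hwj : w j ≠ 0) : ((p ^ 2 : ℕ) : ℚ) < (w j)⁻¹ := by
  by_contra hle
  rw [not_lt] at hle
  obtain ⟨-, hres, hexps⟩ :=
    isMaxInv_residualInvariants_of_graph p 2 (0 : Fin 2) (zero_notMem_vars_h₁₇ (k := k) p) hc hmax hc0 hψ hj hwj hle
  refine hmax.2 _ (bending_mem_admissibleInvariants (k := k) p) ?_
  rw [hexps]
  exact insertionSort_cons_lt_bending p hres.1

/-! ## §3 Order, initial form, `δ` and preparedness of the bent form -/

omit [CharP k p] in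
/-- `ord F_p = p` (the monomial `y^p` has degree `p`, all others degree `≥ p`). (derived here)
[cite: AbramovichTemkinWlodarczyk2024, §5.1 (p. 1575) (a₁ = ord)] -/
theorem monomialOrd_F_bending :
    monomialOrd (fun _ => 1) (X 0 ^ p ^ 2 + (X 1 ^ p + X 1 ^ (p + 1)) : MvPolynomial (Fin 2) k) = p := by
  classical
  have hp0 : 0 < p := hp.out.pos
  have hpp : p ≤ p ^ 2 := Nat.le_self_pow two_ne_zero p
  apply le_antisymm
  · have hn1 : ¬ (Finsupp.single (0 : Fin 2) (p ^ 2) = Finsupp.single 1 p) := fun h => by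
      have h1 := DFunLike.congr_fun h 1
      rw [Finsupp.single_apply, Finsupp.single_apply, if_neg (show (0 : Fin 2) ≠ 1 by decide), if_pos rfl] at h1
      omega
    have hn3 : ¬ (Finsupp.single (1 : Fin 2) (p + 1) = Finsupp.single 1 p) := fun h => by
      have := Finsupp.single_injective _ h
      omega
    have hmem : Finsupp.single (1 : Fin 2) p ∈
        (X 0 ^ p ^ 2 + (X 1 ^ p + X 1 ^ (p + 1)) : MvPolynomial (Fin 2) k).support := by
      rw [mem_support_iff, coeff_add, coeff_add, coeff_X_pow, coeff_X_pow, coeff_X_pow, if_neg hn1, if_pos rfl,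
        if_neg hn3]
      norm_num
    refine (monomialOrd_le_weight (fun _ => 1) hmem).trans (le_of_eq ?_)
    rw [Finsupp.weight_single, smul_eq_mul, mul_one]
  · refine le_monomialOrd_add₁₇ _ ?_ (le_monomialOrd_add₁₇ _ ?_ ?_) <;>
      rw [monomialOrd_X_pow₁₇, mul_one] <;> exact_mod_cast by omega

/-- **`ord G_p = p`**: the order is unchanged by the origin-fixing coordinate change. (derived here)
[cite: AbramovichTemkinWlodarczyk2024, Lemma 5.2.10 (p. 1577)] -/
theorem monomialOrd_bentForm : monomialOrd (fun _ => 1) (bentForm k p) = p := by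
  rw [← addPolyShear_symm_bending, monomialOrd_one_symm_eq _ (isCentreFor_bending (k := k) p).1,
    monomialOrd_F_bending]

omit [CharP k p] in
/-- **`in_p(G_p) = y^p`**: the degree-`p` part of the bent form. (derived here)
[cite: CossartJannsenSaito2020, Def. 8.2 (1) (pp. 117–118) (in_v(f) = F(Y))] -/
theorem homogeneousComponent_bentForm : homogeneousComponent p (bentForm k p) = X 1 ^ p := by
  classical
  have hp0 : 0 < p := hp.out.pos
  have hpp : p ≤ p ^ 2 := Nat.le_self_pow two_ne_zero p
  have hc : ∀ i j : ℕ, homogeneousComponent p (X 0 ^ i * X 1 ^ j : MvPolynomial (Fin 2) k) =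
      if p = i + j then X 0 ^ i * X 1 ^ j else 0 := fun i j =>
    homogeneousComponent_of_mem ((isHomogeneous_X_pow (0 : Fin 2) i).mul (isHomogeneous_X_pow 1 j))
  simp only [bentForm, map_add, map_sub, hc]
  rw [if_pos (zero_add p).symm, if_neg (by omega), if_neg (by omega), if_neg (by omega), if_neg (by omega),
    if_neg (by omega), if_neg (by omega), if_neg (by omega), if_neg (by omega)]
  simp

omit [CharP k p] in
/-- `in_p(G_p) = y^p` involves only `y`: the hypothesis `hFS` of the vertex theorem for `S = {y}`. (derived here)
[cite: CossartJannsenSaito2020, Setup A / Def. 7.1 (p. 121) (u ∉ in_𝔪(f))] -/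
theorem hFS_bentForm : ∀ d ∈ (homogeneousComponent p (bentForm k p)).support, ∀ j ∉ ({1} : Finset (Fin 2)), d j = 0 := by
  classical
  intro d hd j hj
  rw [homogeneousComponent_bentForm, X_pow_eq_monomial] at hd
  have := Finset.mem_singleton.1 (support_monomial_subset hd)
  subst this
  exact Finsupp.single_eq_of_ne (fun h => hj (Finset.mem_singleton.2 h))

omit [CharP k p] in
/-- **`τ(G_p) = 1`** (the directrix of `in_p = y^p` is `{y = 0}`). (derived here)
[cite: CossartJannsenSaito2020, Def. 1.26 / Lemma 1.27 (pp. 22–23)] -/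
theorem hironakaTau_bentForm : hironakaTau k {homogeneousComponent p (bentForm k p)} = 1 := by
  rw [homogeneousComponent_bentForm, hironakaTau_X_pow 1 hp.out.pos.ne']

omit hp [CharP k p] in
/-- The nine exponents of the bent form. (plumbing) [folklore] -/
private theorem mem_support_bentForm {d : Fin 2 →₀ ℕ} (hd : d ∈ (bentForm k p).support) :
    d = Finsupp.single 0 0 + Finsupp.single 1 p ∨ d = Finsupp.single 0 0 + Finsupp.single 1 (p + 1) ∨
    d = Finsupp.single 0 (p ^ 2 + p + 1) + Finsupp.single 1 0 ∨ d = Finsupp.single 0 (p ^ 2 + 2 * p) + Finsupp.single 1 0 ∨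
    d = Finsupp.single 0 (p ^ 2 + 2 * p + 1) + Finsupp.single 1 0 ∨ d = Finsupp.single 0 p + Finsupp.single 1 p ∨
    d = Finsupp.single 0 (p + 1) + Finsupp.single 1 p ∨ d = Finsupp.single 0 (p ^ 2) + Finsupp.single 1 1 ∨
    d = Finsupp.single 0 (p ^ 2 + p) + Finsupp.single 1 1 := by
  classical
  have h1 : ∀ {i j : ℕ} {d : Fin 2 →₀ ℕ}, d ∈ (X 0 ^ i * X 1 ^ j : MvPolynomial (Fin 2) k).support →
      d = Finsupp.single 0 i + Finsupp.single 1 j := fun hd =>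
    Finset.mem_singleton.1 (support_X_pow_mul_X_pow₁₇ _ _ hd)
  unfold bentForm at hd
  rcases Finset.mem_union.1 (support_sub _ _ _ hd) with hd | hd
  · rcases Finset.mem_union.1 (support_add hd) with hd | hd
    · rcases Finset.mem_union.1 (support_add hd) with hd | hd
      · rcases Finset.mem_union.1 (support_add hd) with hd | hd
        · rcases Finset.mem_union.1 (support_add hd) with hd | hd
          · exact Or.inl (h1 hd)
          · exact Or.inr (Or.inl (h1 hd))
        · exact Or.inr (Or.inr (Or.inl (h1 hd)))
      · exact Or.inr (Or.inr (Or.inr (Or.inl (h1 hd))))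
    · exact Or.inr (Or.inr (Or.inr (Or.inr (Or.inl (h1 hd)))))
  · rcases Finset.mem_union.1 (support_add hd) with hd | hd
    · rcases Finset.mem_union.1 (support_add hd) with hd | hd
      · rcases Finset.mem_union.1 (support_add hd) with hd | hd
        · exact Or.inr (Or.inr (Or.inr (Or.inr (Or.inr (Or.inl (h1 hd))))))
        · exact Or.inr (Or.inr (Or.inr (Or.inr (Or.inr (Or.inr (Or.inl (h1 hd)))))))
      · exact Or.inr (Or.inr (Or.inr (Or.inr (Or.inr (Or.inr (Or.inr (Or.inl (h1 hd))))))))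
    · exact Or.inr (Or.inr (Or.inr (Or.inr (Or.inr (Or.inr (Or.inr (Or.inr (h1 hd))))))))

omit [CharP k p] in
/-- The vertex `x^{p²+p+1}` is a monomial of the bent form. (plumbing) [folklore] -/
private theorem vertex_mem_support_bentForm :
    Finsupp.single 0 (p ^ 2 + p + 1) + Finsupp.single 1 0 ∈ (bentForm k p).support := by
  classical
  have hp1 : 1 < p := hp.out.one_lt
  have hpp : p ≤ p ^ 2 := Nat.le_self_pow two_ne_zero p
  have hne : ∀ i j : ℕ, ¬ (i = p ^ 2 + p + 1 ∧ j = 0) →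
      ¬ ((Finsupp.single (0 : Fin 2) i + Finsupp.single 1 j : Fin 2 →₀ ℕ) =
          Finsupp.single 0 (p ^ 2 + p + 1) + Finsupp.single 1 0) := fun i j h h' => h (e_eq_e_iff₁₇.1 h')
  rw [mem_support_iff]
  unfold bentForm
  simp only [coeff_add, coeff_sub, coeff_X_pow_mul_X_pow₁₇, if_true,
    if_neg (hne 0 p fun h => by obtain ⟨h1, h2⟩ := h; omega),
    if_neg (hne 0 (p + 1) fun h => by obtain ⟨h1, h2⟩ := h; omega),
    if_neg (hne (p ^ 2 + 2 * p) 0 fun h => by obtain ⟨h1, h2⟩ := h; omega),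
    if_neg (hne (p ^ 2 + 2 * p + 1) 0 fun h => by obtain ⟨h1, h2⟩ := h; omega),
    if_neg (hne p p fun h => by obtain ⟨h1, h2⟩ := h; omega),
    if_neg (hne (p + 1) p fun h => by obtain ⟨h1, h2⟩ := h; omega),
    if_neg (hne (p ^ 2) 1 fun h => by obtain ⟨h1, h2⟩ := h; omega),
    if_neg (hne (p ^ 2 + p) 1 fun h => by obtain ⟨h1, h2⟩ := h; omega)]
  norm_num

omit [CharP k p] in
/-- **`δ(G_p; x; y) = (p² + p + 1)/p`**: the minimum of `|A|/(p − |B|)` over the monomials `y^B x^A` of `G_p`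
with `|B| < p` — `x^{p²+p+1}, x^{p²+2p}, x^{p²+2p+1}` (`|B| = 0`) and `y x^{p²}, y x^{p²+p}` (`|B| = 1`, values
`p²/(p−1), (p²+p)/(p−1) > (p²+p+1)/p`) — is attained exactly at the vertex `x^{p²+p+1}`. (derived here)
[cite: CossartJannsenSaito2020, Def. 8.1 (3) / Def. 8.2 (1) (pp. 117–118)] -/
theorem hironakaDelta_bentForm :
    hironakaDelta ({1} : Finset (Fin 2)) p (bentForm k p) =
      ((((p ^ 2 + p + 1 : ℕ) : ℚ) / (p : ℚ) : ℚ) : WithTop ℚ) := by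
  classical
  have hp0 : 0 < p := hp.out.pos
  have hp1 : 1 < p := hp.out.one_lt
  have hpq : (1 : ℚ) < p := by exact_mod_cast hp1
  have hpsub : (((p - 1 : ℕ) : ℚ)) = (p : ℚ) - 1 := by rw [Nat.cast_sub hp1.le, Nat.cast_one]
  apply le_antisymm
  · unfold hironakaDelta
    refine (Finset.inf_le (Finset.mem_filter.2 ⟨vertex_mem_support_bentForm (k := k) p, ?_⟩)).trans (le_of_eq ?_)
    · rw [blockDeg_singleton, e_apply_one₁₇]; exact hp0
    · rw [coDeg_singleton, blockDeg_singleton, degree_e₁₇, e_apply_one₁₇, Nat.add_zero, Nat.sub_zero, Nat.sub_zero]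
  · rw [le_hironakaDelta_iff]
    intro d hd hb
    rw [blockDeg_singleton] at hb
    rw [coDeg_singleton, blockDeg_singleton]
    rcases mem_support_bentForm (k := k) p hd with rfl | rfl | rfl | rfl | rfl | rfl | rfl | rfl | rfl <;>
      rw [e_apply_one₁₇] at hb ⊢ <;> (try omega) <;> rw [degree_e₁₇]
    · rw [Nat.add_zero, Nat.sub_zero, Nat.sub_zero]
    · rw [Nat.add_zero, Nat.sub_zero, Nat.sub_zero, div_le_div_iff_of_pos_right (by positivity)]
      exact_mod_cast (by omega : p ^ 2 + p + 1 ≤ p ^ 2 + 2 * p)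
    · rw [Nat.add_zero, Nat.sub_zero, Nat.sub_zero, div_le_div_iff_of_pos_right (by positivity)]
      exact_mod_cast (by omega : p ^ 2 + p + 1 ≤ p ^ 2 + 2 * p + 1)
    · rw [Nat.add_sub_cancel, hpsub, div_le_div_iff₀ (by positivity) (by linarith)]
      push_cast
      nlinarith
    · rw [Nat.add_sub_cancel, hpsub, div_le_div_iff₀ (by positivity) (by linarith)]
      push_cast
      nlinarith

omit [CharP k p] in
/-- **The bent form is `δ`-prepared** (vacuously): `δ = (p²+p+1)/p` is not an integer since `p ∤ p²+p+1`, so no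
lattice point — in particular no vertex of `Δ(G_p; x; y)` — has `|A| = δ`, and there is nothing to dissolve.
(derived here) [cite: CossartJannsenSaito2020, Def. 8.8 / Thm. 8.16 (pp. 119–121) (δ ∉ ℤ ⇒ prepared at the δ-face)] -/
theorem isDeltaPrepared_bentForm : IsDeltaPrepared ({1} : Finset (Fin 2)) p (bentForm k p) := by
  intro v _ hdeg
  exfalso
  have hp0 : 0 < p := hp.out.pos
  have hpq : (p : ℚ) ≠ 0 := by exact_mod_cast hp0.ne'
  rw [hironakaDelta_bentForm, WithTop.coe_eq_coe] at hdeg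
  have h : ((v.degree * p : ℕ) : ℚ) = ((p ^ 2 + p + 1 : ℕ) : ℚ) := by
    rw [Nat.cast_mul, hdeg, div_mul_cancel₀ _ hpq]
  have h' : v.degree * p = p ^ 2 + p + 1 := by exact_mod_cast h
  have hdvd : p ∣ p ^ 2 + p + 1 := ⟨v.degree, by rw [← h', mul_comm]⟩
  have h1 : p ∣ 1 := (Nat.dvd_add_right ⟨p + 1, by ring⟩).1 hdvd
  exact hp.out.one_lt.ne' (Nat.dvd_one.1 h1)

/-! ## §4 Maximality: `max W(x^{p²} + y^p + y^{p+1}) = (p, p² + p + 1)` -/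

/-- `W(F_p) = W(G_p)`: the invariant set is unchanged by the origin-fixing coordinate change. (derived here)
[cite: AbramovichTemkinWlodarczyk2024, Thm. 1.1.1 (3) (p. 1562) (functoriality)] -/
theorem admissibleInvariants_bentForm :
    admissibleInvariants (bentForm k p) =
      admissibleInvariants (X 0 ^ p ^ 2 + (X 1 ^ p + X 1 ^ (p + 1)) : MvPolynomial (Fin 2) k) := by
  rw [← addPolyShear_symm_bending]
  exact admissibleInvariants_map_eq _
    (constantCoeff_symm_X_eq_zero_of_forall _ (isCentreFor_bending (k := k) p).1) _

/-- **Upper bound: no invariant of `F_p = x^{p²} + y^p + y^{p+1}` exceeds `(p, p² + p + 1)`.**  In the bent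
coordinates (`W(F_p) = W(G_p)`): a centre with some weight `> 1/p` has leading invariant `< p`; otherwise the
vertex theorem for the `δ`-prepared `G_p` (`τ = 1`, `δ = (p²+p+1)/p`) gives at least two weights `≥ 1/(p·δ) =
1/(p²+p+1)`, i.e. `b₁ = p` and `b₂ ≤ p² + p + 1`. (derived here)
[cite: CossartJannsenSaito2020, Thm. 8.16 (p. 121) (δ of a prepared polyhedron is invariant) and Def. 8.2]
[cite: AbramovichTemkinWlodarczyk2024, Thm. 5.1.1 / §5.3 (pp. 1575–1578)] -/
theorem not_lt_of_mem_admissibleInvariants_bending {c : List ℚ}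
    (hc : c ∈ admissibleInvariants (X 0 ^ p ^ 2 + (X 1 ^ p + X 1 ^ (p + 1)) : MvPolynomial (Fin 2) k)) :
    ¬ ATW.TruncLex.lt [(p : ℚ), ((p ^ 2 + p + 1 : ℕ) : ℚ)] c := by
  classical
  rw [← admissibleInvariants_bentForm] at hc
  obtain ⟨Ψ, γ, h, rfl⟩ := hc
  have hp0 : 0 < p := hp.out.pos
  have he0 : (0 : ℚ) < p := by exact_mod_cast hp0
  have hord := monomialOrd_bentForm (k := k) p
  have hτ : ({1} : Finset (Fin 2)).card = hironakaTau k {homogeneousComponent p (bentForm k p)} := by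
    rw [hironakaTau_bentForm, Finset.card_singleton]
  have hs := exps_sorted γ
  by_cases hall : ∀ x, γ x ≤ (p : ℚ)⁻¹
  · -- all weights `≤ 1/p`: the vertex theorem applies
    have hle : ∀ i, γ i ≤ ((p : ℕ) : ℚ)⁻¹ := hall
    obtain ⟨es, hes⟩ : ∃ es, exps γ = (p : ℚ) :: es := by
      obtain ⟨t, ht⟩ := replicate_prefix_of_forall_le hord h hle
      rw [hironakaTau_bentForm, List.replicate_one] at ht
      exact ⟨t, ht.symm⟩
    have hcount := succ_card_le_countP_exps_of_isDeltaPrepared hord hτ (hFS_bentForm (k := k) p)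
      (isDeltaPrepared_bentForm (k := k) p) (hironakaDelta_bentForm (k := k) p) h hle
    rw [Finset.card_singleton, hes] at hcount
    have heδ : (p : ℚ) * (((p ^ 2 + p + 1 : ℕ) : ℚ) / (p : ℚ)) = ((p ^ 2 + p + 1 : ℕ) : ℚ) :=
      mul_div_cancel₀ _ he0.ne'
    rw [heδ] at hcount
    rw [hes]
    -- `es` has an entry `≤ p² + p + 1`, hence its head is `≤ p² + p + 1`
    cases es with
    | nil =>
      exfalso
      rw [List.countP_cons, List.countP_nil] at hcount
      split_ifs at hcount <;> omega
    | cons e₂ es' =>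
      have hs₂ : (e₂ :: es').Pairwise (· ≤ ·) := by
        have := hs
        rw [hes] at this
        exact (List.pairwise_cons.1 this).2
      have hex : ∃ x ∈ e₂ :: es', x ≤ ((p ^ 2 + p + 1 : ℕ) : ℚ) := by
        by_contra hne
        push Not at hne
        have h0 : (e₂ :: es').countP (fun x => decide (x ≤ ((p ^ 2 + p + 1 : ℕ) : ℚ))) = 0 := by
          rw [List.countP_eq_zero]
          intro x hx
          simpa using hne x hx
        rw [List.countP_cons, h0] at hcount
        split_ifs at hcount <;> omega
      obtain ⟨x, hx, hxF⟩ := hex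
      have he₂ : e₂ ≤ ((p ^ 2 + p + 1 : ℕ) : ℚ) := (le_of_mem_of_pairwise₁₇ hs₂ hx).trans hxF
      intro hlt
      rw [ATW.TruncLex.cons_lt_cons] at hlt
      rcases hlt with hlt | ⟨-, hlt⟩
      · exact lt_irrefl _ hlt
      · rw [ATW.TruncLex.cons_lt_cons] at hlt
        rcases hlt with hlt | ⟨hEq, hlt⟩
        · exact not_lt.2 he₂ hlt
        · exact ATW.TruncLex.not_nil_lt _ hlt
  · -- some weight exceeds `1/p`: the leading invariant is `< p`
    push Not at hall
    obtain ⟨x, hx⟩ := hall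
    have hγx : 0 < γ x := (inv_pos.2 he0).trans hx
    have hinv : (γ x)⁻¹ < p := by
      have := inv_strictAnti₀ (inv_pos.2 he0) hx
      rwa [inv_inv] at this
    have hmem : (γ x)⁻¹ ∈ exps γ := inv_mem_exps₁₇ hγx.ne'
    intro hlt
    cases hγ : exps γ with
    | nil => rw [hγ] at hmem; simp at hmem
    | cons c₁ cs =>
      rw [hγ] at hmem hlt hs
      have hc₁ : c₁ < p := (le_of_mem_of_pairwise₁₇ hs hmem).trans_lt hinv
      rw [ATW.TruncLex.cons_lt_cons] at hlt
      rcases hlt with hlt | ⟨hEq, -⟩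
      · exact lt_asymm hlt hc₁
      · exact hc₁.ne' hEq

/-- **`max W(x^{p²} + y^p + y^{p+1}) = (p, p² + p + 1)`** in characteristic `p`, over all admissible centres
after all polynomial coordinate changes: the bent centre attains it (`bending_mem_admissibleInvariants`) and
nothing exceeds it (`not_lt_of_mem_admissibleInvariants_bending`).  This is the observatory's bent value
`(p, q + r(q−1)/(p−1))` for `q = p²`, `r = 1` — strictly above every split value (§2). (derived here)
[cite: CossartJannsenSaito2020, Thm. 8.16 (p. 121)] [cite: Hauser2010, §C (p. 9) and §D (p. 12)]
[cite: HauserPerlega2019PRIMS, §7 (p. 798)] -/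
theorem isMaxInv_bending :
    IsMaxInv (admissibleInvariants (X 0 ^ p ^ 2 + (X 1 ^ p + X 1 ^ (p + 1)) : MvPolynomial (Fin 2) k))
      [(p : ℚ), ((p ^ 2 + p + 1 : ℕ) : ℚ)] :=
  ⟨bending_mem_admissibleInvariants p, fun _ hc => not_lt_of_mem_admissibleInvariants_bending p hc⟩

end Bending

/-! ## §5 Characteristic `2`: `max W(x⁴ + y² + y³) = (2, 7)` -/

/-- **`(2, 7) ∈ W(x⁴ + y² + y³)` in characteristic `2`** — realised by the centre `((y + x² + x³)^{1/2}, x^{1/7})`;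
the split law offers at most `(2, 4)`.  (The observatory's engine 1 certifies `max W(x⁴ + y² + y³) = (2, 7)`;
maximality is not typed here.) (derived here) [cite: AbramovichTemkinWlodarczyk2024, Thm. 5.3.1 (2) (p. 1578)]
[cite: Hauser2010, §D (p. 12)] -/
theorem bending_mem_admissibleInvariants_two [CharP k 2] :
    [(2 : ℚ), 7] ∈ admissibleInvariants (X 0 ^ 4 + (X 1 ^ 2 + X 1 ^ 3) : MvPolynomial (Fin 2) k) := by
  haveI : Fact (Nat.Prime 2) := ⟨Nat.prime_two⟩
  have h := bending_mem_admissibleInvariants (k := k) 2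
  norm_num at h
  exact h

/-- **`max W(x⁴ + y² + y³) = (2, 7)` in characteristic `2`** (engine 1's headline number: the bent value, not the
split value `(2, 4)`). (derived here) [cite: Hauser2010, §C (p. 9) and §D (p. 12)]
[cite: CossartJannsenSaito2020, Thm. 8.16 (p. 121)] -/
theorem isMaxInv_bending_two [CharP k 2] :
    IsMaxInv (admissibleInvariants (X 0 ^ 4 + (X 1 ^ 2 + X 1 ^ 3) : MvPolynomial (Fin 2) k)) [(2 : ℚ), 7] := by
  haveI : Fact (Nat.Prime 2) := ⟨Nat.prime_two⟩
  have h := isMaxInv_bending (k := k) 2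
  norm_num at h
  exact h

end WeightedBlowup

end Literature.AlgebraicGeometry.Resolution
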